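import Summits.QuantumFields.BalabanUV.T4Continuum.Support.VariationalCovariantPoincareLocal
import Summits.QuantumFields.BalabanUV.T4Continuum.Support.VariationalCovariantScalarPairClosedRel

/-!
# T⁴ programme, spine node NE2 (U1a), road P2 supplier item (O6)(d) — THE SCALAR COVARIANT CANONICAL PAIR, CLOSED, FRAME-FREE:
# the road owner's R2 `VariationalCovariantScalarPairClosedRel.scalar_pair_closed_rel` (UB⁺ relative to a reference transport `T₀`) RE-RUN with
# leaf P⁺ taken from the RELATIVE, frame-free coercivity `VariationalCovariantPoincareLocal.qW_le_coarse_rel` ∕ `qV_le_composite_rel` —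
# the ten global-frame binders `hG hc hframe hblock hsmall hG′ hc′ hframe′ hblock′ hsmall′` are GONE; smallness is PER UNIT BLOCK

NE2 formalisation swarm, leaf prover 01 (gen 4); the road owner t4-ne2-p2-g11's «leaf-01 DO IT» (CLAIMS.log l.11061 (2)), shape as ruled there:
 * §1 **`scalar_pair_bracket_sqrt_local`** — the abstract bracket `VariationalCovariantAssemblySqrt.pair_bracket_sqrt` (this lineage, gen 2) on the
   charged-scalar carriers with `hPc` ∕ `hPf` DISCHARGED frame-free: reference unit transport `T₀` with in-block defect `w₀` (UB⁺-rel's `hw`), relative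
   phase `‖T·conj T₀ − 1‖ ≤ γ`, `2d(n·w₀)² + 4γ² ≤ ½`; one step: unit `T′`, in-block defect `w₁` (`2d(L·w₁)² ≤ ½`); FED⁺ mismatch `m` with
   `64d(n·m)² ≤ ½`; ANY constant `C_P ≥ 136` (the local coercivity's `136` weakened inside, `Sc + nsq ≥ 0`);
 * §2 **`scalar_pair_closed_local`** — R2 re-run: ALL FIVE LEAVES discharged BY NAME (UB⁺-rel `exists_ub_scalarPair_rel_eff` = the owner's R1 on
   leaf-04-g2's engine, ONE⁺ `blockSpin_Q1_le` leaf-01-g2, REG⁺ `hREG_rho` leaf-09-g3, UB⁺ one level up `fine_ub_of_coarse_sqrt` leaf-01-g2, FED⁺ ∕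
   P⁺-rel), conclusion = p213521's ∕ R2's `let` telescope VERBATIM (`C_P := 1088·d + 128`, `Λc` at the fictitious `w′`), so the owner's
   `towerLimitRate_of_closedBrackets` (p213959) applies unchanged; binders: `1 ≤ d` (for `136 ≤ 1088d + 128` — the one extra, harmless line),
   target `T` (unit), reference `T₀` (unit, `hw`, `hrel ≤ γ < 1`, `hsmall : 2d(n·w)² + 4γ² ≤ ½`, fictitious `w′`), one-step `T′` (unit) whose ONE⁺
   in-block defect `m₁` (`hin`) DOUBLES as the fine P⁺ datum (`hsmall₁ : 2d(L·m₁)² ≤ ½`), `hR′`, `mis ≤ m` with `habsorb : 64d(n·m)² ≤ ½`, `hcross`,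
   plaquette `a`; NO frames, NO «global small field».
The frame-free END (`VariationalCovariantEndLocal`) on this is the OWNER's (l.11061).

HONEST FRAMING (T4-DAG p. 1).  Rung (B)+1 only — NOT infinite volume, NOT a mass gap, NOT Clay.  NE2 is NOT IN PRINT and NOT proved here, on
either road.  MODEL LEVEL (U(1) = King's model): bond phases `Rc` (unit), `R′` (contractive), UNIT site transports `T, T₀, T′` are DATA; scalar
sector.  Honest limit: «small field PER UNIT BLOCK, k-uniform for the class» (`n·w`, `γ`, `n·m`, `L·m₁` small).  Everything OURS and elementary;
nothing printed is a hypothesis; no `def … : Prop`; no `sorry`.  HONEST DEPENDENCY: continuum YM on T⁴ ⇐ BetaPertH ∧ nine spine estimates (0/9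
proved); BetaPertH ⇐ (D1) ∧ (D4) ∧ CAP+tail; G-an2-4 gates asym, D1 and NE2/3/4.
-/

noncomputable section

namespace Summit.QuantumFields.BalabanUV.T4Continuum.VariationalCovariantScalarPairLocal

open Finset
open scoped ComplexConjugate
open Literature.MathematicalPhysics.QuantumFieldTheory.Balaban1983to89
open Literature.MathematicalPhysics.QuantumFieldTheory.Balaban1983to89.B5Prop11Plancherel (Tor fine unitVec)
open Literature.MathematicalPhysics.QuantumFieldTheory.Balaban1983to89.B5Prop11Lower (nsq nsq_nonneg)
open Literature.MathematicalPhysics.QuantumFieldTheory.Balaban1983to89.B5Block118 (bpt)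
open Summit.QuantumFields.BalabanUV.T4Continuum.VariationalTransfer (blockSpin)
open Summit.QuantumFields.BalabanUV.T4Continuum.VariationalCovariantFederbush (cD dirU Qc mis)
open Summit.QuantumFields.BalabanUV.T4Continuum.VariationalCovariantScalarPair
  (Sc Sf qW qV Qk Q1 Sc_nonneg Sf_nonneg qW_nonneg qV_nonneg norm_sq_le_qW norm_sq_le_qV continuous_Qc continuous_sum_dirU Q1_surjective
   Sc_Q1_le)
open Summit.QuantumFields.BalabanUV.T4Continuum.VariationalCovariantAssemblySqrt (pair_bracket_sqrt)
open Summit.QuantumFields.BalabanUV.T4Continuum.VariationalCovariantPoincareLocal (qW_le_coarse_rel qV_le_composite_rel)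
open Summit.QuantumFields.BalabanUV.T4Continuum.VariationalCovariantUpperSqrt (fine_ub_of_coarse_sqrt)
open Summit.QuantumFields.BalabanUV.T4Continuum.VariationalCovariantUpperBoundRel (exists_ub_scalarPair_rel_eff)
open Summit.QuantumFields.BalabanUV.T4Continuum.VariationalCovariantOneStepPhys (blockSpin_Q1_le)
open Summit.QuantumFields.BalabanUV.T4Continuum.VariationalCovariantInterpolant (rho rho_nonneg)
open Summit.QuantumFields.BalabanUV.T4Continuum.VariationalCovariantRegularityRho (hREG_rho)

variable {d : ℕ} (n L : ℕ) [NeZero n] [NeZero L] (M : Fin d → ℕ) [hM : ∀ μ, NeZero (M μ)]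

/-! ## §1 The additive bracket with P⁺ frame-free (relative form), any `C_P ≥ 136` -/

/-- **THE ADDITIVE BRACKET FOR KING'S CHARGED SCALAR, CANONICAL PAIR, ONE⁺ IN THE HONEST SHAPE, P⁺ FRAME-FREE**: `pair_bracket_sqrt` with the P⁺
inputs from `VariationalCovariantPoincareLocal.qW_le_coarse_rel` ∕ `qV_le_composite_rel` — reference unit transport `T₀` (in-block defect `w₀`,
relative phase `γ` to the constraint's `T`), unit one-step `T′` (in-block defect `w₁`), FED⁺ mismatch `m`; any `C_P ≥ 136`. [folklore] -/
theorem scalar_pair_bracket_sqrt_local {Rc : Tor (fine n M) → Fin d → ℂ} {R' : Tor (fine L (fine n M)) → Fin d → ℂ}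
    {T T₀ : Tor (fine n M) → ℂ} {T' : Tor (fine L (fine n M)) → ℂ}
    (hT₀ : ∀ x, ‖T₀ x‖ = 1) {w₀ γ : ℝ}
    (hw₀ : ∀ (y : Tor M) (j : Fin d → Fin n) (μ : Fin d), (j μ : ℕ) + 1 < n →
      ‖Rc (bpt n M y j) μ * conj (T₀ (bpt n M y j + unitVec (fine n M) μ)) * T₀ (bpt n M y j) - 1‖ ≤ w₀)
    (hrel : ∀ x, ‖T x * conj (T₀ x) - 1‖ ≤ γ)
    (hsmall : 2 * (d : ℝ) * ((n : ℝ) * w₀) ^ 2 + 4 * γ ^ 2 ≤ 1 / 2)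
    (hT1 : ∀ x, ‖T' x‖ = 1) {w₁ : ℝ}
    (hw₁ : ∀ (y : Tor (fine n M)) (j : Fin d → Fin L) (μ : Fin d), (j μ : ℕ) + 1 < L →
      ‖R' (bpt L (fine n M) y j) μ * conj (T' (bpt L (fine n M) y j + unitVec (fine L (fine n M)) μ)) * T' (bpt L (fine n M) y j) - 1‖ ≤ w₁)
    (hsmall₁ : 2 * (d : ℝ) * ((L : ℝ) * w₁) ^ 2 ≤ 1 / 2)
    (hR' : ∀ x μ, ‖R' x μ‖ ≤ 1) {m : ℝ} (hm : 0 ≤ m)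
    (hmis : ∀ y μ j, ‖mis L (fine n M) Rc R' T' y μ j‖ ≤ m) (habsorb : 64 * (d : ℝ) * ((n : ℝ) * m) ^ 2 ≤ 1 / 2)
    {CP : ℝ} (hCP : 136 ≤ CP)
    {Λ CR ε₁ δ' : ℝ} (hΛ : 0 ≤ Λ) (hCR : 0 ≤ CR) (hε₁ : 0 ≤ ε₁) (hδ' : 0 ≤ δ') {ρ : (Tor (fine n M) → ℂ) → ℝ} (hρ0 : ∀ f, 0 ≤ ρ f)
    -- leaf UB⁺ at both levels
    (hUBc : ∀ μ : Tor M → ℂ, ∃ f, Qk n M T f = μ ∧ Sc n M Rc f ≤ Λ * nsq μ)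
    (hUBf : ∀ μ : Tor M → ℂ, ∃ f', Qk n M T (Q1 n L M T' f') = μ ∧ Sf n L M R' f' ≤ Λ * nsq μ)
    -- leaf ONE⁺ in the honest covariant shape, leaf REG⁺
    (hONE : ∀ f, blockSpin (Q1 n L M T') (Sf n L M R') f ≤ (Real.sqrt (Sc n M Rc f + ε₁ * ρ f) + δ' * Real.sqrt (qW n M f)) ^ 2)
    (hREG : ∀ (μ : Tor M → ℂ) f, Qk n M T f = μ → (∀ g, Qk n M T g = μ → Sc n M Rc f ≤ Sc n M Rc g) →
      ρ f ≤ CR * (Sc n M Rc f + nsq μ))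
    (μ : Tor M → ℂ) :
    blockSpin (Qk n M T) (Sc n M Rc) μ ≤ blockSpin (Qk n M T ∘ Q1 n L M T') (Sf n L M R') μ
        + (2 * (Real.sqrt d * ((n : ℝ) * m)) * Real.sqrt (Λ * (CP * (Λ + 1)))
            + (Real.sqrt d * ((n : ℝ) * m)) ^ 2 * (CP * (Λ + 1))) * nsq μ ∧
      blockSpin (Qk n M T ∘ Q1 n L M T') (Sf n L M R') μ ≤ blockSpin (Qk n M T) (Sc n M Rc) μ
        + (ε₁ * CR * (Λ + 1) + 2 * δ' * Real.sqrt ((Λ + ε₁ * CR * (Λ + 1)) * (CP * (Λ + 1)))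
            + δ' ^ 2 * (CP * (Λ + 1))) * nsq μ := by
  have hL1 : (1 : ℝ) ≤ L := by exact_mod_cast Nat.one_le_iff_ne_zero.mpr (NeZero.ne L)
  have hnLd : (0 : ℝ) ≤ ((n : ℝ) * L) ^ d := by positivity
  have hCP0 : (0 : ℝ) ≤ CP := le_trans (by norm_num) hCP
  have hδ : 0 ≤ Real.sqrt d * ((n : ℝ) * m) := by positivity
  have hT' : ∀ x, ‖T' x‖ ≤ 1 := fun x => (hT1 x).le
  have hnormW : ∀ f : Tor (fine n M) → ℂ, ‖f‖ ^ 2 ≤ ((n : ℝ) * L) ^ d * qW n M f := by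
    intro f
    refine (norm_sq_le_qW n M f).trans (mul_le_mul_of_nonneg_right ?_ (qW_nonneg n M f))
    rw [mul_pow]
    exact le_mul_of_one_le_right (by positivity) (one_le_pow₀ hL1)
  have hnormV : ∀ f' : Tor (fine L (fine n M)) → ℂ, ‖f'‖ ^ 2 ≤ ((n : ℝ) * L) ^ d * qV n L M f' := norm_sq_le_qV n L M
  -- P⁺ frame-free at both levels, weakened to the constant `CP`
  have hPc : ∀ f, qW n M f ≤ CP * (Sc n M Rc f + nsq (Qk n M T f)) := fun f =>
    (qW_le_coarse_rel n M hT₀ hw₀ hrel hsmall f).trans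
      (mul_le_mul_of_nonneg_right hCP (add_nonneg (Sc_nonneg n M Rc f) (nsq_nonneg _)))
  have hPf : ∀ f', qV n L M f' ≤ CP * (Sf n L M R' f' + nsq (Qk n M T (Q1 n L M T' f'))) := fun f' =>
    (qV_le_composite_rel n L M hT₀ hw₀ hrel hsmall hT1 hw₁ hsmall₁ hR' hm hmis habsorb f').trans
      (mul_le_mul_of_nonneg_right hCP (add_nonneg (Sf_nonneg n L M R' f') (nsq_nonneg _)))
  refine pair_bracket_sqrt (V := Tor (fine L (fine n M)) → ℂ) (W := Tor (fine n M) → ℂ) (Z := Tor M → ℂ)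
    (Qk := Qk n M T) (Q₁ := Q1 n L M T') (Sc := Sc n M Rc) (Sf := Sf n L M R') (qW := qW n M) (qV := qV n L M) (qZ := nsq) (ρ := ρ)
    (continuous_Qc T) (continuous_Qc T') ?_ ?_ (Q1_surjective n L M T' hT1)
    (Sc_nonneg n M Rc) (Sf_nonneg n L M R') (qV_nonneg n L M) (qW_nonneg n M) (fun μ => nsq_nonneg μ) hρ0
    hnLd hΛ hCP0 hCR hδ hε₁ hδ' hnormW hnormV hUBc hUBf hPc hPf ?_ hONE hREG μ
  · exact continuous_sum_dirU Rc _
  · exact continuous_sum_dirU R' _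
  · intro f'
    exact Sc_Q1_le n L M hR' hT' hm hmis f'

/-! ## §2 The canonical pair CLOSED, frame-free (R2 re-run) -/

/-- **THE SCALAR COVARIANT CANONICAL PAIR, ALL LEAVES DISCHARGED, UB⁺ RELATIVE TO A REFERENCE TRANSPORT `T₀`, NO FRAMES** (model level; only
DATA hypotheses remain; conclusion = `scalar_pair_closed`'s ∕ `scalar_pair_closed_rel`'s `let`s at `w := w′`, VERBATIM).  Compared with the owner's
R2 the ten frame binders are replaced by `hsmall : 2d(n·w)² + 4γ² ≤ ½` (the reference transport's in-block defect + the relative phase),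
`hsmall₁ : 2d(L·m₁)² ≤ ½` (ONE⁺'s one-step in-block defect read as the fine P⁺ datum) and `habsorb : 64d(n·m)² ≤ ½`; `1 ≤ d`. [folklore] -/
theorem scalar_pair_closed_local (hd : 1 ≤ d) {Rc : Tor (fine n M) → Fin d → ℂ} {R' : Tor (fine L (fine n M)) → Fin d → ℂ}
    {T : Tor (fine n M) → ℂ} {T' : Tor (fine L (fine n M)) → ℂ}
    -- FED⁺ data (one-block transport mismatch)
    (hR' : ∀ x μ, ‖R' x μ‖ ≤ 1) (hT1 : ∀ x, ‖T' x‖ = 1) {m : ℝ} (hm : 0 ≤ m)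
    (hmis : ∀ y μ j, ‖mis L (fine n M) Rc R' T' y μ j‖ ≤ m) (habsorb : 64 * (d : ℝ) * ((n : ℝ) * m) ^ 2 ≤ 1 / 2)
    -- unit-modulus transports and phases at level n
    (hT1c : ∀ x, ‖T x‖ = 1) (hRc1 : ∀ y μ, ‖Rc y μ‖ = 1)
    -- the REFERENCE transport, its in-block defect, the relative phase, the per-block smallness, the fictitious defect `w′`
    {T₀ : Tor (fine n M) → ℂ} (hT₀ : ∀ x, ‖T₀ x‖ = 1) {w : ℝ} (hw0 : 0 ≤ w)
    (hw : ∀ (y : Tor M) (j : Fin d → Fin n) (μ : Fin d), (j μ : ℕ) + 1 < n →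
      ‖Rc (bpt n M y j) μ * conj (T₀ (bpt n M y j + unitVec (fine n M) μ)) * T₀ (bpt n M y j) - 1‖ ≤ w)
    {γ : ℝ} (hγ : γ < 1) (hrel : ∀ x, ‖T x * conj (T₀ x) - 1‖ ≤ γ)
    (hsmall : 2 * (d : ℝ) * ((n : ℝ) * w) ^ 2 + 4 * γ ^ 2 ≤ 1 / 2)
    {w' : ℝ} (hw'0 : 0 ≤ w') (hw' : (4 + n * w) / (1 - γ) - 1 ≤ n * w')
    -- REG⁺ data: plaquette defect
    {a : ℝ} (ha : 0 ≤ a)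
    (hP : ∀ x μ ν, ‖Rc x μ * Rc (x + unitVec (fine n M) μ) ν - Rc x ν * Rc (x + unitVec (fine n M) ν) μ‖ ≤ a)
    -- ONE⁺ data: one-step in-block / crossing defects `m₁` of `(R′, T′, Rc)`; `m₁` is ALSO the fine P⁺ datum
    {m₁ : ℝ} (hm₁ : 0 ≤ m₁)
    (hin : ∀ (y : Tor (fine n M)) (j : Fin d → Fin L) (μ : Fin d), (j μ : ℕ) + 1 < L →
      ‖R' (bpt L (fine n M) y j) μ * conj (T' (bpt L (fine n M) y j + unitVec (fine L (fine n M)) μ)) * T' (bpt L (fine n M) y j) - 1‖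
        ≤ m₁)
    (hcross : ∀ (y : Tor (fine n M)) (j : Fin d → Fin L) (μ : Fin d), (j μ : ℕ) + 1 = L →
      ‖R' (bpt L (fine n M) y j) μ * conj (T' (bpt L (fine n M) y j + unitVec (fine L (fine n M)) μ)) * T' (bpt L (fine n M) y j)
        - Rc y μ‖ ≤ m₁)
    (hsmall₁ : 2 * (d : ℝ) * ((L : ℝ) * m₁) ^ 2 ≤ 1 / 2)
    (μ : Tor M → ℂ) :
    let Λc : ℝ := 2 * d * (36 : ℝ) ^ d * ((1 + n * w') ^ 2 + 9)
    let CP : ℝ := 1088 * d + 128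
    let CR : ℝ := 2 * Λc + 2 * d * (a * (n : ℝ) ^ 2) + (d : ℝ) ^ 2 * (a * (n : ℝ) ^ 2) ^ 2 * CP
    let ε₁ : ℝ := ((d : ℝ) / 4 + 1 / 2) * ((L : ℝ) / (n : ℝ) ^ 2)
    let δ' : ℝ := Real.sqrt (2 * d * (1 + (d : ℝ) ^ 2)) * ((n : ℝ) * L * m₁)
    let Λ : ℝ := Λc + (ε₁ * CR + 2 * δ' * Real.sqrt ((1 + ε₁ * CR) * CP) + δ' ^ 2 * CP) * (Λc + 1)
    blockSpin (Qk n M T) (Sc n M Rc) μ ≤ blockSpin (Qk n M T ∘ Q1 n L M T') (Sf n L M R') μ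
        + (2 * (Real.sqrt d * ((n : ℝ) * m)) * Real.sqrt (Λ * (CP * (Λ + 1)))
            + (Real.sqrt d * ((n : ℝ) * m)) ^ 2 * (CP * (Λ + 1))) * nsq μ ∧
      blockSpin (Qk n M T ∘ Q1 n L M T') (Sf n L M R') μ ≤ blockSpin (Qk n M T) (Sc n M Rc) μ
        + (ε₁ * CR * (Λ + 1) + 2 * δ' * Real.sqrt ((Λ + ε₁ * CR * (Λ + 1)) * (CP * (Λ + 1)))
            + δ' ^ 2 * (CP * (Λ + 1))) * nsq μ := by
  intro Λc CP CR ε₁ δ' Λ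
  have hn0 : (0 : ℝ) < n := by exact_mod_cast Nat.pos_of_ne_zero (NeZero.ne n)
  have hL1 : (1 : ℝ) ≤ L := by exact_mod_cast Nat.one_le_iff_ne_zero.mpr (NeZero.ne L)
  have hdR : (1 : ℝ) ≤ d := by exact_mod_cast hd
  have hΛc : 0 ≤ Λc := by positivity
  have hCP : (136 : ℝ) ≤ CP := by show (136 : ℝ) ≤ 1088 * d + 128; linarith
  have hCP0 : 0 ≤ CP := le_trans (by norm_num) hCP
  have hα : 0 ≤ a * (n : ℝ) ^ 2 := by positivity
  have hCR : 0 ≤ CR := by positivity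
  have hε₁ : 0 ≤ ε₁ := by positivity
  have hδ' : 0 ≤ δ' := by positivity
  have hetil : 0 ≤ (ε₁ * CR + 2 * δ' * Real.sqrt ((1 + ε₁ * CR) * CP) + δ' ^ 2 * CP) * (Λc + 1) := by positivity
  have hΛ : 0 ≤ Λ := add_nonneg hΛc hetil
  have hRc : ∀ y μ, ‖Rc y μ‖ ≤ 1 := fun y μ => (hRc1 y μ).le
  -- UB⁺ at level n RELATIVE TO THE REFERENCE `T₀` (owner's R1 on leaf-04 gen 2's engine), in the capstone's letters
  have hUBc0 : ∀ μ : Tor M → ℂ, ∃ f, Qk n M T f = μ ∧ Sc n M Rc f ≤ Λc * nsq μ := by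
    intro ν
    obtain ⟨f, hf, hb⟩ := exists_ub_scalarPair_rel_eff n M hT₀ hRc hw0 hw hγ hrel hw' ν
    exact ⟨f, hf, hb⟩
  -- P⁺ frame-free at both levels (this lineage gen 4), weakened to `CP`
  have hPc : ∀ f, qW n M f ≤ CP * (Sc n M Rc f + nsq (Qk n M T f)) := fun f =>
    (qW_le_coarse_rel n M hT₀ hw hrel hsmall f).trans
      (mul_le_mul_of_nonneg_right hCP (add_nonneg (Sc_nonneg n M Rc f) (nsq_nonneg _)))
  have hPf : ∀ f', qV n L M f' ≤ CP * (Sf n L M R' f' + nsq (Qk n M T (Q1 n L M T' f'))) := fun f' =>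
    (qV_le_composite_rel n L M hT₀ hw hrel hsmall hT1 hin hsmall₁ hR' hm hmis habsorb f').trans
      (mul_le_mul_of_nonneg_right hCP (add_nonneg (Sf_nonneg n L M R' f') (nsq_nonneg _)))
  -- ONE⁺ (leaf-01 gen 2), honest shape
  have hONE : ∀ f, blockSpin (Q1 n L M T') (Sf n L M R') f
      ≤ (Real.sqrt (Sc n M Rc f + ε₁ * rho n M Rc f) + δ' * Real.sqrt (qW n M f)) ^ 2 := fun f =>
    blockSpin_Q1_le n L M hT1 hRc1 hm₁ hin hcross f
  -- REG⁺ (leaf-09 gen 3), for leaf ONE⁺'s ρ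
  have hREG : ∀ (ν : Tor M → ℂ) f, Qk n M T f = ν → (∀ g, Qk n M T g = ν → Sc n M Rc f ≤ Sc n M Rc g) →
      rho n M Rc f ≤ CR * (Sc n M Rc f + nsq ν) := hREG_rho n M hT1c hRc1 ha hP hΛc hUBc0 hPc
  -- the structure hypotheses of the abstract lemmas
  have hnLd : (0 : ℝ) ≤ ((n : ℝ) * L) ^ d := by positivity
  have hnormW : ∀ f : Tor (fine n M) → ℂ, ‖f‖ ^ 2 ≤ ((n : ℝ) * L) ^ d * qW n M f := by
    intro f
    refine (norm_sq_le_qW n M f).trans (mul_le_mul_of_nonneg_right ?_ (qW_nonneg n M f))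
    rw [mul_pow]
    exact le_mul_of_one_le_right (by positivity) (one_le_pow₀ hL1)
  have hnormV : ∀ f' : Tor (fine L (fine n M)) → ℂ, ‖f'‖ ^ 2 ≤ ((n : ℝ) * L) ^ d * qV n L M f' := norm_sq_le_qV n L M
  -- UB⁺ one level up from the coarse one, sqrt world (leaf-01 gen 2's `fine_ub_of_coarse_sqrt`)
  have hUBf : ∀ ν : Tor M → ℂ, ∃ f', Qk n M T (Q1 n L M T' f') = ν ∧ Sf n L M R' f' ≤ Λ * nsq ν := by
    intro ν
    exact fine_ub_of_coarse_sqrt (V := Tor (fine L (fine n M)) → ℂ) (W := Tor (fine n M) → ℂ) (Z := Tor M → ℂ)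
      (Qk := Qk n M T) (Q₁ := Q1 n L M T') (Sc := Sc n M Rc) (Sf := Sf n L M R') (qW := qW n M) (qV := qV n L M) (qZ := nsq)
      (ρ := rho n M Rc) (continuous_Qc T) (continuous_Qc T') (continuous_sum_dirU Rc _) (continuous_sum_dirU R' _)
      (Q1_surjective n L M T' hT1) (Sc_nonneg n M Rc) (Sf_nonneg n L M R') (qW_nonneg n M) (fun μ => nsq_nonneg μ)
      (rho_nonneg n M Rc) hnLd hnLd hΛc hCP0 hCR hε₁ hδ' hnormW hnormV hUBc0 hPc hPf hONE hREG ν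
  -- the coarse UB⁺ with the common (larger) constant
  have hUBc : ∀ ν : Tor M → ℂ, ∃ f, Qk n M T f = ν ∧ Sc n M Rc f ≤ Λ * nsq ν := by
    intro ν
    obtain ⟨f, hf, hb⟩ := hUBc0 ν
    exact ⟨f, hf, hb.trans (mul_le_mul_of_nonneg_right (le_add_of_nonneg_right hetil) (nsq_nonneg ν))⟩
  exact scalar_pair_bracket_sqrt_local n L M hT₀ hw hrel hsmall hT1 hin hsmall₁ hR' hm hmis habsorb hCP
    hΛ hCR hε₁ hδ' (rho_nonneg n M Rc) hUBc hUBf hONE hREG μ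

end Summit.QuantumFields.BalabanUV.T4Continuum.VariationalCovariantScalarPairLocal

end
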